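import Mathlib
import Summits.ResolutionOfSingularities.ResolutionOfSingularities.Theorems.HomologicalConductorPersistenceConductorFloorGeneral
import Literature.RingTheory.CohomologyAnnihilator.StableAnnihilation
import Literature.RingTheory.CohomologyAnnihilator.StrongGenerator
import Literature.RingTheory.CohomologyAnnihilator.TowerBasic
import HarnessLib

/-!
# Rung S-2 `PersistenceSurface` (stmt-ResolutionOfSingularities-19970) — the CONDUCTOR FLOOR for EVERY conductor:
# `𝔠³·ca³(C) ⊆ ca³(B)` for every module-finite birational extension `B ⊆ C`, `C` a noetherian domain

Route `ResolutionOfSingularities/HomologicalConductor`, chain W4.4b (cell `res-hironaka`), rung S-2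
`PersistenceSurface` (stmt-ResolutionOfSingularities-19970), registered stub
`stub_levelFourPersistenceNonnormalOrNonrational'` (L-other′; class Σ8 = NON-NORMAL stage `0`), cell R5 / S-c.
Seat res-L1-w44b-stub-3 (gen 7); third part of `…PersistenceConductorFloorGeneral` (p555200: `W(Bⁿ) ≅ 𝔠ⁿ`, `W(P)` a
retract of `𝔠ⁿ`, projective conductors) and `…PersistenceConductorFloorSyzygy` (second-syzygy conductors).  Here NO
hypothesis on the conductor is left.  `[OURS · L1 w44b]`; folklore module theory; NOT a statement of the manuscript
under review (Hironaka 2017) and no statement of that manuscript is used; AI-written, weaker than expert review.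

## The observation

For ANY ideal `𝔠 ⊆ C`, every `y ∈ 𝔠` kills `Extʲ_C(𝔠, –)` for `j ≥ 1`: `Extʲ(𝔠, N) ↪ Extʲ⁺¹(C/𝔠, N)` (as `C` is
projective) and `𝔠 = Ann(C/𝔠)` kills every `Ext(C/𝔠, –)`.  Since `W(P) = Hom_B(C, P)` is a retract of `𝔠ⁿ`
(p555200) every conductor element kills `Ext^{≥1}_C(W(P), –)`, and the Ext bookkeeping of `…ConductorFloorSyzygy`
runs with a CONDUCTOR element `y₁` in place of the syzygy hypothesis:

* `smul_ext_eq_zero_of_mem_annihilator` — `y ∈ Ann_C(M)` kills `Extⁱ(M, N)` (all `i`, all `N`).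
* `smul_ext_eq_zero_of_mem_ideal` — `y ∈ I` kills `Extʲ(I, N)` for `j ≥ 1`.
* `smul_ext_coext_eq_zero_of_mem_conductor` — `y ∈ 𝔠` kills `Extʲ(W(P), N)` for `j ≥ 1`, `P` finitely generated
  projective over `B`.
* `mul_mem_cohomologyAnnihilatorOfDegree_three_of_conductor_of_forall_smul_ext` — the abstract kernel: if `y₁`
  kills `Ext¹_C(W(P), N)` for all finitely generated projective `P` and finitely generated `N`, and `y₂ ∈ ca³(C)`,
  then `c·(c'·y₁y₂) ∈ ca³(B)` for conductor elements `c, c'` (for a second `B`-syzygy `K = ker(P → P')`,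
  `W(K) = ker(W(P) → W(P') ↪ 𝔠ⁿ' ↪ Cⁿ')`; with `N ⊆ Cⁿ'` the image, `0 → W(K) → W(P) → N → 0` is short exact and
  `y₂ · Ext²(N, –) = y₂ · Ext³(Cⁿ'/N, –) = 0`, so `y₁y₂ · Ext¹(W(K), –) = 0`; dual splitting; p551581's transfer; CA1).
* **`mul_mem_cohomologyAnnihilatorOfDegree_three_of_conductor`** — THE FLOOR FOR EVERY CONDUCTOR: `B → C` injective
  and birational, `B`, `C` noetherian, `C` a domain; `c, c' ∈ B` conductor elements, `y₁ ∈ 𝔠`, `y₂ ∈ ca³(C)`,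
  `b = c'·y₁y₂`: then `c·b ∈ ca³(B)`.  So **`𝔠³·ca³(C) ⊆ ca³(B)`** — with p550697's ceiling
  `𝔠³·ca³(C) ⊆ ca³(B) ⊆ 𝔠` at EVERY non-normal stage with module-finite normalisation, no `S₂` / Gorenstein /
  principal-conductor proviso; radically `V(ca³ B) = V(𝔠) ∪ π(V(ca³ C))` (using `Sing C ⊆ π⁻¹ Sing B` for `⊆`).
* `Subalgebra.mul_conductor_mem_cohomologyAnnihilatorOfDegree_three` — the same in the route's vocabulary
  (subalgebras `B ≤ C` of a field `K` with `Frac B = K`).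

References (mechanism only): S. B. Iyengar, R. Takahashi, IMRN 2016, Remark 2.13 [`IyengarTakahashi2014`].
-/

-- single-problem summit: the doubled namespace component `ResolutionOfSingularities` is forced
set_option linter.dupNamespace false

noncomputable section

open CategoryTheory CategoryTheory.Abelian Literature.RingTheory.CohomologyAnnihilator
open Summit.ResolutionOfSingularities.ResolutionOfSingularities.Theorems.NoZeno.SandwichCluster
open Summit.ResolutionOfSingularities.ResolutionOfSingularities.Theorems.HomologicalConductor.PersistenceConductorCoextension
  (stablyAnnihilates_of_coextension_factor)
open Summit.ResolutionOfSingularities.ResolutionOfSingularities.Theorems.HomologicalConductor.PersistenceConductorFloorGeneral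
  (exists_coext_retract_pi_conductor finite_coext)

universe u

namespace Summit.ResolutionOfSingularities.ResolutionOfSingularities.Theorems.HomologicalConductor.PersistenceConductorFloorUnconditional

/-! ## Annihilators kill `Ext`; an ideal kills its own positive `Ext` -/

section Annihilator

variable {A : Type u} [CommRing A]

/-- **`Ann(M)` kills `Extⁱ(M, N)`**: `y • e = mk₀(y • 𝟙_M) ∘ e` and `y • 𝟙_M = 0`. [folklore] -/
theorem smul_ext_eq_zero_of_mem_annihilator {M N : ModuleCat.{u} A} {y : A}
    (hy : y ∈ Module.annihilator A M) {i : ℕ} (e : Ext.{u} M N i) : y • e = 0 := by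
  have h0 : y • 𝟙 M = 0 := by
    ext m
    simp only [ModuleCat.hom_smul, ModuleCat.hom_id, ModuleCat.hom_zero, LinearMap.smul_apply,
      LinearMap.id_apply, LinearMap.zero_apply]
    exact Module.mem_annihilator.mp hy m
  rw [smul_eq_mk₀_smul_id_comp, h0, Ext.mk₀_zero, Ext.zero_comp]

/-- **An ideal kills its own positive `Ext`**: for `y ∈ I` and `j ≥ 1`, `y · Extʲ_A(I, N) = 0`
(`0 → I → A → A/I → 0`, `A` projective, `I = Ann(A/I)` … `⊆`). [folklore] -/
theorem smul_ext_eq_zero_of_mem_ideal (I : Ideal A) {y : A} (hy : y ∈ I) (N : ModuleCat.{u} A) {j : ℕ}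
    (hj : 1 ≤ j) (e : Ext.{u} (ModuleCat.of A ↥I) N j) : y • e = 0 := by
  obtain ⟨w, hS⟩ := exists_shortExact_of_linearMap (Y := ModuleCat.of A ↥I) (M := ModuleCat.of A A)
    (X := ModuleCat.of A (A ⧸ I)) I.subtype I.mkQ (Submodule.injective_subtype _) (Submodule.mkQ_surjective _)
    (LinearMap.exact_subtype_mkQ _)
  haveI : HasProjectiveDimensionLT (ShortComplex.mk (ModuleCat.ofHom I.subtype) (ModuleCat.ofHom I.mkQ) w).X₂ 1 := by
    change HasProjectiveDimensionLT (ModuleCat.of A A) 1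
    infer_instance
  refine smul_ext_eq_zero_of_shortExact_of_hasProjectiveDimensionLT hS (n := 1) hj (fun e' => ?_) e
  refine smul_ext_eq_zero_of_mem_annihilator (Module.mem_annihilator.mpr fun m => ?_) e'
  change y • (m : A ⧸ I) = 0
  obtain ⟨a, rfl⟩ := Submodule.mkQ_surjective I m
  rw [Submodule.mkQ_apply, ← Submodule.Quotient.mk_smul, Submodule.Quotient.mk_eq_zero, smul_eq_mul]
  exact I.mul_mem_right a hy

end Annihilator

variable {B C : Type u} [CommRing B] [CommRing C] [Algebra B C]

/-! ## Conductor elements kill `Ext^{≥1}(W(P), –)` -/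

/-- **Every `y ∈ 𝔠` kills `Extʲ_C(W(P), N)` for `j ≥ 1`**, `P` finitely generated projective over `B` (any
conductor): `W(P)` is a retract of `𝔠ⁿ` (p555200) and `y` kills `Ext^{≥1}(𝔠, –)`. [folklore] -/
theorem smul_ext_coext_eq_zero_of_mem_conductor [IsDomain C] (hinj : Function.Injective (algebraMap B C))
    (hbir : ∀ γ : C, ∃ b : B, b ≠ 0 ∧ ∃ b' : B, algebraMap B C b' = algebraMap B C b * γ)
    (𝔠 : Ideal C) (h𝔠 : ∀ γ : C, γ ∈ 𝔠 ↔ ∀ δ : C, ∃ b : B, algebraMap B C b = γ * δ)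
    {y : C} (hy : y ∈ 𝔠)
    (P : Type u) [AddCommGroup P] [Module B P] [Module.Finite B P] [Module.Projective B P]
    (N : ModuleCat.{u} C) {j : ℕ} (hj : 1 ≤ j)
    (e : Ext.{u} (ModuleCat.of C (((ModuleCat.restrictScalars (algebraMap B C)).obj (ModuleCat.of C C))
      →ₗ[B] P)) N j) :
    y • e = 0 := by
  obtain ⟨n, i, p, h⟩ := exists_coext_retract_pi_conductor hinj hbir 𝔠 h𝔠 P
  have hpi : ∀ e' : Ext.{u} (ModuleCat.of C (Fin n → ↥𝔠)) N j, y • e' = 0 := fun e' =>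
    ext_smul_eq_zero_of_pi (G := ModuleCat.of C ↥𝔠) y (fun e'' => smul_ext_eq_zero_of_mem_ideal 𝔠 hy N hj e'')
      n e'
  refine ext_smul_eq_zero_of_retract (X := ModuleCat.of C (((ModuleCat.restrictScalars (algebraMap B C)).obj
      (ModuleCat.of C C)) →ₗ[B] P)) (Z := ModuleCat.of C (Fin n → ↥𝔠))
    (ModuleCat.ofHom i) (ModuleCat.ofHom p) ?_ y hpi e
  ext θ w
  simpa using LinearMap.congr_fun (h θ) w

/-! ## The abstract kernel: a factor killing `Ext¹(W(P), –)` and a factor in `ca³(C)` -/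

/-- **The conductor floor, abstract kernel.**  `B → C` injective and birational, `B`, `C` noetherian, `C` a domain,
`𝔠 ⊆ C` the conductor; if `y₁ ∈ C` kills `Ext¹_C(W(P), N)` for every finitely generated projective `B`-module `P`
and finitely generated `N`, and `y₂ ∈ ca³(C)`, then `c·(c'·y₁y₂) ∈ ca³(B)` for conductor elements `c, c'`.
Proof (as in `…ConductorFloorSyzygy`): for a second `B`-syzygy `K = ker(P → P')`,
`W(K) = ker(W(P) → W(P') ↪ 𝔠ⁿ' ↪ Cⁿ')`; with `N ⊆ Cⁿ'` the image, `0 → W(K) → W(P) → N → 0` is short exact and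
`y₂ · Ext²(N, –) = y₂ · Ext³(Cⁿ'/N, –) = 0`, so `y₁y₂ · Ext¹(W(K), –) = 0` (tree `mul_smul_ext_eq_zero_of_shortExact`);
dual splitting factors `y₁y₂ • 𝟙_{W(K)}` through a finite free module; p551581's transfer; CA1.
[cite: IyengarTakahashi2014, Remark 2.13] -/
theorem mul_mem_cohomologyAnnihilatorOfDegree_three_of_conductor_of_forall_smul_ext [IsNoetherianRing B]
    [IsDomain C] [IsNoetherianRing C] (hinj : Function.Injective (algebraMap B C))
    (hbir : ∀ γ : C, ∃ b : B, b ≠ 0 ∧ ∃ b' : B, algebraMap B C b' = algebraMap B C b * γ)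
    (𝔠 : Ideal C) (h𝔠 : ∀ γ : C, γ ∈ 𝔠 ↔ ∀ δ : C, ∃ b : B, algebraMap B C b = γ * δ)
    {c c' : B} (hc : ∀ γ : C, ∃ b : B, algebraMap B C b = algebraMap B C c * γ)
    (hc' : ∀ γ : C, ∃ b : B, algebraMap B C b = algebraMap B C c' * γ)
    {y₁ y₂ : C}
    (hy₁ : ∀ (P : Type u) [AddCommGroup P] [Module B P], Module.Finite B P → Module.Projective B P →
      ∀ (N : ModuleCat.{u} C), Module.Finite C N →
        ∀ e : Ext.{u} (ModuleCat.of C (((ModuleCat.restrictScalars (algebraMap B C)).obj (ModuleCat.of C C))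
          →ₗ[B] P)) N 1, y₁ • e = 0)
    (hy₂ : y₂ ∈ cohomologyAnnihilatorOfDegree C 3)
    {b : B} (hb : algebraMap B C b = algebraMap B C c' * (y₁ * y₂)) :
    c * b ∈ cohomologyAnnihilatorOfDegree B 3 := by
  refine (mem_cohomologyAnnihilatorOfDegree_succ_iff_forall_isSyzygy (n := 2) (c * b)).mpr
    fun M K hM hK => ?_
  -- unpack the second `B`-syzygy `K ↪ P ↠ K' ↪ P' ↠ K'' ≅ M`
  obtain ⟨K', P, h1, hPfin, hPproj, f, g, w, hS⟩ := hK
  obtain ⟨K'', P', -, hP'fin, hP'proj, f', g', w', hS'⟩ := h1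
  haveI := hPfin
  haveI := hP'fin
  haveI : Module.Projective B P := (IsProjective.iff_projective (R := B) P).mpr hPproj
  haveI : Module.Projective B P' := (IsProjective.iff_projective (R := B) P').mpr hP'proj
  have hf : Function.Injective f.hom := (ModuleCat.mono_iff_injective f).mp hS.mono_f
  have hf' : Function.Injective f'.hom := (ModuleCat.mono_iff_injective f').mp hS'.mono_f
  let φ : P →ₗ[B] P' := f'.hom ∘ₗ g.hom
  have hfφ : LinearMap.range f.hom = LinearMap.ker φ := by
    rw [LinearMap.ker_comp_of_ker_eq_bot _ (LinearMap.ker_eq_bot.mpr hf')]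
    exact hS.exact.moduleCat_range_eq_ker
  haveI hWP : Module.Finite C (((ModuleCat.restrictScalars (algebraMap B C)).obj (ModuleCat.of C C)) →ₗ[B] P) :=
    finite_coext hinj hbir 𝔠 h𝔠 P
  -- `W(φ) : W(P) → W(P')`, `W(f) : W(K) → W(P)`, and `W(P') ↪ 𝔠ⁿ' ↪ Cⁿ'`
  let Wφ : (((ModuleCat.restrictScalars (algebraMap B C)).obj (ModuleCat.of C C)) →ₗ[B] P) →ₗ[C]
      (((ModuleCat.restrictScalars (algebraMap B C)).obj (ModuleCat.of C C)) →ₗ[B] P') :=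
    { toFun := fun θ => φ ∘ₗ θ
      map_add' := fun θ θ' => LinearMap.comp_add _ _ _
      map_smul' := fun s θ => by apply LinearMap.ext; intro w; rfl }
  let Wf : (((ModuleCat.restrictScalars (algebraMap B C)).obj (ModuleCat.of C C)) →ₗ[B] K) →ₗ[C]
      (((ModuleCat.restrictScalars (algebraMap B C)).obj (ModuleCat.of C C)) →ₗ[B] P) :=
    { toFun := fun θ => f.hom ∘ₗ θ
      map_add' := fun θ θ' => LinearMap.comp_add _ _ _
      map_smul' := fun s θ => by apply LinearMap.ext; intro w; rfl }
  have hWf : Function.Injective Wf := by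
    intro θ θ' hθ
    apply LinearMap.ext
    intro w
    exact hf (LinearMap.congr_fun hθ w)
  obtain ⟨n', i', p', hi'p'⟩ := exists_coext_retract_pi_conductor hinj hbir 𝔠 h𝔠 P'
  let ψ : (((ModuleCat.restrictScalars (algebraMap B C)).obj (ModuleCat.of C C)) →ₗ[B] P) →ₗ[C]
      (Fin n' → C) :=
    (LinearMap.compLeft 𝔠.subtype (Fin n')) ∘ₗ i' ∘ₗ Wφ
  have hψker : ∀ θ, ψ θ = 0 ↔ Wφ θ = 0 := by
    intro θ
    constructor
    · intro h
      have h2 : i' (Wφ θ) = 0 := by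
        ext j
        exact congrFun h j
      rw [← hi'p' (Wφ θ), h2, map_zero]
    · intro h
      change LinearMap.compLeft 𝔠.subtype (Fin n') (i' (Wφ θ)) = 0
      rw [h, map_zero, map_zero]
  -- exactness of `0 → W(K) → W(P) → range ψ → 0`
  have hexa : Function.Exact Wf ψ.rangeRestrict := by
    rw [LinearMap.exact_iff, LinearMap.ker_rangeRestrict]
    ext θ'
    rw [LinearMap.mem_ker, hψker]
    constructor
    · intro hθ'
      have hmem : ∀ w, θ' w ∈ LinearMap.range f.hom := fun w => by
        rw [hfφ, LinearMap.mem_ker]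
        exact LinearMap.congr_fun hθ' w
      refine ⟨(LinearEquiv.ofInjective f.hom hf).symm.toLinearMap ∘ₗ
        LinearMap.codRestrict (LinearMap.range f.hom) θ' hmem, ?_⟩
      apply LinearMap.ext
      intro w
      exact LinearEquiv.ofInjective_symm_apply (h := hf) f.hom ⟨θ' w, hmem w⟩
    · rintro ⟨θ'', rfl⟩
      apply LinearMap.ext
      intro w
      have hw : f.hom (θ'' w) ∈ LinearMap.ker φ := hfφ ▸ LinearMap.mem_range_self _ _
      exact hw
  obtain ⟨wa, hSa⟩ := exists_shortExact_of_linearMap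
    (Y := ModuleCat.of C (((ModuleCat.restrictScalars (algebraMap B C)).obj (ModuleCat.of C C)) →ₗ[B] K))
    (M := ModuleCat.of C (((ModuleCat.restrictScalars (algebraMap B C)).obj (ModuleCat.of C C)) →ₗ[B] P))
    (X := ModuleCat.of C ↥(LinearMap.range ψ)) Wf ψ.rangeRestrict hWf
    (LinearMap.surjective_rangeRestrict ψ) hexa
  -- exactness of `0 → range ψ → Cⁿ' → Cⁿ' ⧸ range ψ → 0` (free middle term)
  obtain ⟨wb, hSb⟩ := exists_shortExact_of_linearMap (X := ModuleCat.of C ((Fin n' → C) ⧸ LinearMap.range ψ))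
    (M := ModuleCat.of C (Fin n' → C)) (Y := ModuleCat.of C ↥(LinearMap.range ψ)) (LinearMap.range ψ).subtype
    (LinearMap.range ψ).mkQ (Submodule.injective_subtype _) (Submodule.mkQ_surjective _)
    (LinearMap.exact_subtype_mkQ _)
  haveI : HasProjectiveDimensionLT (ShortComplex.mk (ModuleCat.ofHom (LinearMap.range ψ).subtype)
      (ModuleCat.ofHom (LinearMap.range ψ).mkQ) wb).X₂ 1 := by
    change HasProjectiveDimensionLT (ModuleCat.of C (Fin n' → C)) 1
    infer_instance
  -- `W(K)` is finitely generated; a finite free presentation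
  haveI hWK : Module.Finite C (((ModuleCat.restrictScalars (algebraMap B C)).obj (ModuleCat.of C C))
      →ₗ[B] K) := Module.Finite.of_injective Wf hWf
  obtain ⟨m, q, hq⟩ := Module.Finite.exists_fin' C
    (((ModuleCat.restrictScalars (algebraMap B C)).obj (ModuleCat.of C C)) →ₗ[B] K)
  have hSq := LinearMap.shortExact_shortComplexKer hq
  haveI : Module.Finite C (LinearMap.ker q) := Module.IsNoetherian.finite C _
  -- the kill: `y₁y₂ · Ext¹_C(W(K), N) = 0` for finitely generated `N`
  have hkill : ∀ (N : ModuleCat.{u} C), Module.Finite C N →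
      ∀ e : Ext.{u} (ModuleCat.of C (((ModuleCat.restrictScalars (algebraMap B C)).obj (ModuleCat.of C C))
        →ₗ[B] K)) N 1, (y₁ * y₂) • e = 0 := by
    intro N hN e
    haveI := hN
    have hb2 : ∀ e' : Ext.{u} (ModuleCat.of C ↥(LinearMap.range ψ)) N 2, y₂ • e' = 0 := fun e' =>
      smul_ext_eq_zero_of_shortExact_of_hasProjectiveDimensionLT hSb (n := 1) (i := 2) (by omega)
        (fun e'' => smul_eq_zero_of_mem_cohomologyAnnihilatorOfDegree hy₂ (le_refl 3) e'') e'
    exact mul_smul_ext_eq_zero_of_shortExact hSa (i := 1)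
      (fun e'' => hy₁ P inferInstance inferInstance N hN e'') hb2 e
  have hcls : (y₁ * y₂) • hSq.extClass = 0 := hkill _ inferInstance _
  obtain ⟨χ, hχ⟩ := exists_comp_eq_smul_id_X₃_of_smul_extClass_eq_zero hSq hcls
  have hχq : ∀ θ, q (χ.hom θ) = (y₁ * y₂) • θ := fun θ => by
    have := congrArg (fun ξ => ξ.hom θ) hχ
    simpa using this
  exact stablyAnnihilates_of_coextension_factor hinj hc hc' K hb χ.hom q hχq

/-! ## The floor for every conductor -/

/-- **THE CONDUCTOR FLOOR FOR EVERY CONDUCTOR: `𝔠³·ca³(C) ⊆ ca³(B)`.**  `B → C` injective and birational, `B`, `C`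
noetherian, `C` a domain, `𝔠 ⊆ C` its conductor (`γ ∈ 𝔠 ↔ γ·C ⊆ B`); for conductor elements `c, c' ∈ B`, `y₁ ∈ 𝔠`,
`y₂ ∈ ca³(C)` and `b ∈ B` with `b = c'·y₁y₂` in `C`: `c·b ∈ ca³(B)`.  With p550697's ceiling `ca³(B) ⊆ 𝔠` this
pinches `ca³` of every non-normal stage with module-finite normalisation: `𝔠³·ca³(T̄₀) ⊆ ca³(T₀) ⊆ 𝔠`.
[cite: IyengarTakahashi2014, Remark 2.13] -/
theorem mul_mem_cohomologyAnnihilatorOfDegree_three_of_conductor [IsNoetherianRing B] [IsDomain C]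
    [IsNoetherianRing C] (hinj : Function.Injective (algebraMap B C))
    (hbir : ∀ γ : C, ∃ b : B, b ≠ 0 ∧ ∃ b' : B, algebraMap B C b' = algebraMap B C b * γ)
    (𝔠 : Ideal C) (h𝔠 : ∀ γ : C, γ ∈ 𝔠 ↔ ∀ δ : C, ∃ b : B, algebraMap B C b = γ * δ)
    {c c' : B} (hc : ∀ γ : C, ∃ b : B, algebraMap B C b = algebraMap B C c * γ)
    (hc' : ∀ γ : C, ∃ b : B, algebraMap B C b = algebraMap B C c' * γ)
    {y₁ y₂ : C} (hy₁ : y₁ ∈ 𝔠) (hy₂ : y₂ ∈ cohomologyAnnihilatorOfDegree C 3)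
    {b : B} (hb : algebraMap B C b = algebraMap B C c' * (y₁ * y₂)) :
    c * b ∈ cohomologyAnnihilatorOfDegree B 3 :=
  mul_mem_cohomologyAnnihilatorOfDegree_three_of_conductor_of_forall_smul_ext hinj hbir 𝔠 h𝔠 hc hc'
    (fun P _ _ _ _ N _ e => smul_ext_coext_eq_zero_of_mem_conductor hinj hbir 𝔠 h𝔠 hy₁ P N le_rfl e) hy₂ hb

/-- **`c·(c'·(c''·y)) ∈ ca³(B)`** for three conductor elements `c, c', c'' ∈ B` and `y ∈ ca³(C)` — the floor with
all three conductor factors taken in `B`. [cite: IyengarTakahashi2014, Remark 2.13] -/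
theorem mul_mem_cohomologyAnnihilatorOfDegree_three_of_conductor₃ [IsNoetherianRing B] [IsDomain C]
    [IsNoetherianRing C] (hinj : Function.Injective (algebraMap B C))
    (hbir : ∀ γ : C, ∃ b : B, b ≠ 0 ∧ ∃ b' : B, algebraMap B C b' = algebraMap B C b * γ)
    (𝔠 : Ideal C) (h𝔠 : ∀ γ : C, γ ∈ 𝔠 ↔ ∀ δ : C, ∃ b : B, algebraMap B C b = γ * δ)
    {c c' c'' : B} (hc : ∀ γ : C, ∃ b : B, algebraMap B C b = algebraMap B C c * γ)
    (hc' : ∀ γ : C, ∃ b : B, algebraMap B C b = algebraMap B C c' * γ)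
    (hc'' : ∀ γ : C, ∃ b : B, algebraMap B C b = algebraMap B C c'' * γ)
    {y : C} (hy : y ∈ cohomologyAnnihilatorOfDegree C 3)
    {b : B} (hb : algebraMap B C b = algebraMap B C c' * (algebraMap B C c'' * y)) :
    c * b ∈ cohomologyAnnihilatorOfDegree B 3 :=
  mul_mem_cohomologyAnnihilatorOfDegree_three_of_conductor hinj hbir 𝔠 h𝔠 hc hc'
    ((h𝔠 _).mpr fun δ => hc'' δ) hy hb

/-! ## The route's vocabulary: subalgebras `B ≤ C` of a field -/

section RouteVocabulary

variable {k K : Type u} [Field k] [Field K] [Algebra k K]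

/-- **The conductor floor for every conductor, route vocabulary.**  `B ≤ C` subalgebras of a field `K` over `k`
with `Frac B = K`, `B`, `C` noetherian; `c, c', c'' ∈ B` with `c·C, c'·C, c''·C ⊆ B`, `y ∈ ca³(C)` and
`b = c'·c''·y ∈ B`: then `c·b ∈ ca³(B)` — i.e. `𝔠³·ca³(C) ⊆ ca³(B)` for the conductor `𝔠 = (B : C)`.
[cite: IyengarTakahashi2014, Remark 2.13] -/
theorem _root_.Subalgebra.mul_conductor_mem_cohomologyAnnihilatorOfDegree_three
    (B C : Subalgebra k K) (hBC : B ≤ C) [IsFractionRing ↥B K] [IsNoetherianRing ↥B] [IsNoetherianRing ↥C]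
    {c c' c'' b : ↥B} (hc : ∀ γ ∈ C, (c : K) * γ ∈ B) (hc' : ∀ γ ∈ C, (c' : K) * γ ∈ B)
    (hc'' : ∀ γ ∈ C, (c'' : K) * γ ∈ B)
    {y : ↥C} (hy : y ∈ cohomologyAnnihilatorOfDegree ↥C 3) (hb : (b : K) = (c' : K) * ((c'' : K) * (y : K))) :
    c * b ∈ cohomologyAnnihilatorOfDegree ↥B 3 := by
  letI : Algebra ↥B ↥C := (Subalgebra.inclusion hBC).toRingHom.toAlgebra
  have hinj : Function.Injective (algebraMap ↥B ↥C) := Subalgebra.inclusion_injective hBC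
  have hbir : ∀ γ : ↥C, ∃ b : ↥B, b ≠ 0 ∧ ∃ b' : ↥B, algebraMap ↥B ↥C b' = algebraMap ↥B ↥C b * γ := by
    intro γ
    obtain ⟨⟨b', b⟩, h⟩ := IsLocalization.surj (nonZeroDivisors ↥B) (γ : K)
    refine ⟨b.1, nonZeroDivisors.ne_zero b.2, b', Subtype.ext ?_⟩
    change (b' : K) = (b.1 : K) * (γ : K)
    have h' : (γ : K) * (b.1 : K) = (b' : K) := h
    rw [← h', mul_comm]
  -- the conductor ideal of `↥C`
  let 𝔠 : Ideal ↥C :=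
    { carrier := {γ | ∀ δ : ↥C, (γ : K) * δ ∈ B}
      add_mem' := fun {a a'} ha ha' δ => by
        rw [Subalgebra.coe_add, add_mul]
        exact B.add_mem (ha δ) (ha' δ)
      zero_mem' := fun δ => by
        rw [Subalgebra.coe_zero, zero_mul]
        exact B.zero_mem
      smul_mem' := fun s {a} ha δ => by
        rw [smul_eq_mul, Subalgebra.coe_mul, mul_assoc, mul_left_comm]
        simpa [Subalgebra.coe_mul] using ha (s * δ) }
  have h𝔠 : ∀ γ : ↥C, γ ∈ 𝔠 ↔ ∀ δ : ↥C, ∃ x : ↥B, algebraMap ↥B ↥C x = γ * δ := by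
    intro γ
    change (∀ δ : ↥C, (γ : K) * δ ∈ B) ↔ _
    refine forall_congr' fun δ => ⟨fun h => ⟨⟨(γ : K) * δ, h⟩, Subtype.ext rfl⟩, fun ⟨x, hx⟩ => ?_⟩
    have : ((γ * δ : ↥C) : K) = (x : K) := by rw [← hx]; rfl
    rw [Subalgebra.coe_mul] at this
    rw [this]
    exact x.2
  have hcond : ∀ {c : ↥B}, (∀ γ ∈ C, (c : K) * γ ∈ B) →
      ∀ γ : ↥C, ∃ x : ↥B, algebraMap ↥B ↥C x = algebraMap ↥B ↥C c * γ :=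
    fun {c} hc γ => ⟨⟨(c : K) * γ, hc γ γ.2⟩, Subtype.ext rfl⟩
  have hb' : algebraMap ↥B ↥C b = algebraMap ↥B ↥C c' * (algebraMap ↥B ↥C c'' * y) := Subtype.ext hb
  exact mul_mem_cohomologyAnnihilatorOfDegree_three_of_conductor₃ hinj hbir 𝔠 h𝔠 (hcond hc) (hcond hc')
    (hcond hc'') hy hb'

end RouteVocabulary

end Summit.ResolutionOfSingularities.ResolutionOfSingularities.Theorems.HomologicalConductor.PersistenceConductorFloorUnconditional

end
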